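import Literature.NumberTheory.Sieve.ChenShifted
import Literature.NumberTheory.Sieve.ChenTheoremINumerics
import Literature.NumberTheory.Sieve.ChenSieveProductFixed
import HarnessLib

/-!
# Chen's Theorem II: the assembly of §III at Chen's parameters, for every even shift `h`

Chen Jing-run, Sci. Sinica 16 (1973) 157–176, §III (PDF p. 168 of the reprint in Wang Yuan (ed.),
*Goldbach Conjecture*, 1984): "By (34) and Lemmas 8 and 9, we obtain `P_x(1,2) ≥ 0.67 x C_x/(log x)²`
… By the same method as used in estimating `P_x(1,2)`, we can easily find that
`x_h(1,2) ≥ 0.67 x C_h/(log x)²`, and Theorem II follows." This file PROVES that assembly for the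
shifted sequence `𝒜_h(x) = {p + h : p ≤ x}` of `ChenShifted` (`shiftSieveSet`, `chenZ x = ⌈x^{1/10}⌉`,
`chenY h x = ⌈(x + h + 1)^{1/3}⌉`, `chenSetBShift`):

* `shiftedPrimeAlmostPrimeCount_ge_of` — for a fixed even `h ≠ 0`, the three sieve estimates at
  Chen's parameters, in the unit `W_h(x) = x V_h(x^{1/10})/log x` (`V_h = sieveProduct h`):
  (A) `S(𝒜_h(x), x^{1/10}) ≥ (f₁(5) − ε) W_h(x)` (Chen's (31); `f₁ = lowerSieveFun 1`),
  (B) `∑_{x^{1/10} ≤ q < y} S(𝒜_h(x)_q, x^{1/10}) ≤ (b + ε) W_h(x)` (Chen's (32);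
      `b = ∫_{1/10}^{1/3} F₁(5 − 10β) dβ/β`, `F₁ = upperSieveFun 1`),
  (C) `S(B_h(x), y) ≤ ((2e^γ/5) c' + ε) W_h(x)` (Chen's Lemma 8; `c' = switchingConstantTenth`),
  each for every `ε > 0` and all large `x`, imply `x_h(1,2) ≥ 0.67 x C_h/(log x)²` for all large `x`;
* `Chen1973_theoremII_of` — hence (A), (B), (C) for every even `h ≠ 0` imply
  `Literature.NumberTheory.Sieve.Chen.Chen1973_theoremII` as vendored in `ChenTwin`.

Everything else in Chen's §III is PROVED in the tree and used here: the weighted-sieve inequality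
(34) (`ChenSieve.weightedSieve'`, `ChenWeightedSieve`), the passage `T ≤ y + S(B_h, y)` and
`#{P₂ ∈ 𝒜_h(x)} ≤ x_h(1,2)` (`ChenShifted`), Mertens' asymptotics
`V_h(x^{1/10}) = (1 + o(1)) 20 e^{−γ} C_h/log x` for FIXED `h` (`ChenSieveProductFixed`), and the
numerical margin `20 e^{−γ}(f₁(5) − b/2 − (e^γ/5) c') > 0.676` (`chen_theoremII_margin` below, the
`20e^{−γ}`-normalised sharpening of `chen_theoremI_mainInequality` of `ChenTheoremINumerics`, from
`lowerSieveFun_five_sub_half_integral`, Chen's (33) `chen_lowerSieveIntegral_ge` and `c' < 0.4911`; the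
slack `0.006` absorbs the `ε`-losses). The three
hypotheses are the statements still to be proved for the shifted sequence (for the Goldbach
sequence `{x − p}` they are the hypotheses of `Chen1973_theoremI_of` in `ChenTheoremIAssembly`, of
which (A) is proved in `ChenTheoremISiftedLower`; (A) for the shifted sequence is
`roughCount_shift_tenth_lower` in `ChenShiftedSiftedLower`). No named facts are introduced (D-0026).

Remark on `chenSetBShift` (hypothesis (C)): its elements are `p₁p₂p₃ − h` with ℕ-subtraction, which
could only produce the junk value `0` if `p₁p₂p₃ ≤ h`; since `p₂, p₃ ≥ y > (x + h)^{1/3}` this never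
happens for `x ≥ 1`, and in any case `B_h(x)` enters only through the UPPER bound (C) and the
inequality `T ≤ y + S(B_h(x), y)` (`tripleCount_shift_le`), so an inflated `B_h(x)` is harmless.

## References

* Chen Jing-run, Sci. Sinica 16 (1973) 157–176, Theorem II, §III and Lemmas 8–9 (reprint PDF
  pp. 150, 166–168). [ChenSciSinica1973]
* M. B. Nathanson, *Additive Number Theory: The Classical Bases*, GTM 164 (1996), §10.8.
  [Nathanson1996]
-/

open Finset Filter Topology
open scoped ArithmeticFunction.Omega

noncomputable section

namespace Literature.NumberTheory.Sieve.Chen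

open ChenSieve

/-- **The numerical margin of Chen's Theorems I–II in Chen's normalisation.** With
`b = ∫_{1/10}^{1/3} F₁(5 − 10β) dβ/β` and `c' = switchingConstantTenth`:
`20 e^{−γ} (f₁(5) − b/2 − (e^γ/5) c') > 0.676` — by `lowerSieveFun_five_sub_half_integral`
(`f₁(5) − b/2 = (e^γ/5)(log 2 + 2∫_3^4 ((5/2 − u)/(u(5 − u))) J(u − 1) du)`) the left side is
`4 log 2 + 8 ∫_3^4 ((5/2 − u)/(u(5 − u))) J(u − 1) du − 4c'`, and Chen's (33) (`chen_lowerSieveIntegral_ge`),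
`c' < 0.4911` (`switchingConstantTenth_lt`) and `chen_mainConstant_gt` give `> 0.676` (Chen:
`2.6408 − 1.9702 = 0.6706 ≥ 0.67`; `chen_theoremI_mainInequality` is the same bracket against the sharp
threshold `0.67 e^γ/20`). [cite: ChenSciSinica1973, §III (reprint p. 168)] -/
theorem chen_theoremII_margin :
    (0.676 : ℝ) < 20 * Real.exp (-Real.eulerMascheroniConstant) *
      (lowerSieveFun 1 5 - (∫ β in (1 / 10 : ℝ)..(1 / 3), upperSieveFun 1 (5 - 10 * β) / β) / 2 -
        Real.exp Real.eulerMascheroniConstant / 5 * switchingConstantTenth) := by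
  set G : ℝ := Real.exp Real.eulerMascheroniConstant with hG
  have hG0 : 0 < G := Real.exp_pos _
  have h1 := lowerSieveFun_five_sub_half_integral
  rw [← hG] at h1
  have e : 20 * Real.exp (-Real.eulerMascheroniConstant) *
      (lowerSieveFun 1 5 - (∫ β in (1 / 10 : ℝ)..(1 / 3), upperSieveFun 1 (5 - 10 * β) / β) / 2 -
        G / 5 * switchingConstantTenth) =
      4 * Real.log 2 + 8 * (∫ u in (3 : ℝ)..4, (5 / 2 - u) / (u * (5 - u)) * linearSieveJ (u - 1)) -
        4 * switchingConstantTenth := by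
    rw [show lowerSieveFun 1 5 - (∫ β in (1 / 10 : ℝ)..(1 / 3), upperSieveFun 1 (5 - 10 * β) / β) / 2 -
        G / 5 * switchingConstantTenth =
        (lowerSieveFun 1 5 - (∫ β in (1 / 10 : ℝ)..(1 / 3), upperSieveFun 1 (5 - 10 * β) / β) / 2) -
          G / 5 * switchingConstantTenth by ring, h1, Real.exp_neg, ← hG]
    field_simp
    ring
  rw [e]
  have hM := chen_lowerSieveIntegral_ge
  have hc := switchingConstantTenth_lt
  have hnum := chen_mainConstant_gt
  norm_num at hnum ⊢
  linarith

/-- Mertens for the unit `W_h(x) = x V_h(x^{1/10})/log x`: for even `h ≠ 0` and `ε > 0`, eventually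
`(1 − ε) · 20 e^{−γ} · C_h x/(log x)² ≤ W_h(x)` (`ChenSieveProductFixed` at `z = x^{1/10}`,
`log z = (log x)/10`). [cite: ChenSciSinica1973, Lemma 9 eq. (29) (reprint p. 167)] -/
theorem eventually_shiftUnit_ge {h : ℕ} (hh : Even h) (hh0 : h ≠ 0) {ε : ℝ} (hε : 0 < ε) :
    ∀ᶠ x : ℕ in atTop,
      (1 - ε) * (20 * Real.exp (-Real.eulerMascheroniConstant) *
          (singularSeries h * x / Real.log x ^ 2)) ≤
        (x : ℝ) * sieveProduct h ((x : ℝ) ^ (1 / 10 : ℝ)) / Real.log x := by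
  have hz : Tendsto (fun x : ℕ => ((x : ℝ)) ^ (1 / 10 : ℝ)) atTop atTop :=
    (tendsto_rpow_atTop (by norm_num : (0 : ℝ) < 1 / 10)).comp tendsto_natCast_atTop_atTop
  filter_upwards [hz.eventually (eventually_sieveProduct_mem_Icc hh hh0 hε), eventually_ge_atTop 2]
    with x hx hx2
  have hx1 : (1 : ℝ) < x := by exact_mod_cast (show 1 < x by omega)
  have hx0 : (0 : ℝ) < x := by linarith
  have hlog : 0 < Real.log x := Real.log_pos hx1
  have hV : (1 - ε) * (2 * singularSeries h * Real.exp (-Real.eulerMascheroniConstant) /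
      Real.log ((x : ℝ) ^ (1 / 10 : ℝ))) ≤ sieveProduct h ((x : ℝ) ^ (1 / 10 : ℝ)) := hx.1
  rw [Real.log_rpow hx0] at hV
  have hS := singularSeries_pos h
  have hunit : 0 ≤ (x : ℝ) / Real.log x := by positivity
  have key := mul_le_mul_of_nonneg_left hV hunit
  have e : (x : ℝ) / Real.log x * ((1 - ε) * (2 * singularSeries h *
      Real.exp (-Real.eulerMascheroniConstant) / (1 / 10 * Real.log ↑x))) =
      (1 - ε) * (20 * Real.exp (-Real.eulerMascheroniConstant) *
        (singularSeries h * x / Real.log x ^ 2)) := by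
    field_simp
    ring
  rw [e] at key
  calc _ ≤ _ := key
    _ = _ := by ring

/-- **Chen's §III for the shifted sequence, one shift.** For a fixed even `h ≠ 0`: if, in the unit
`W_h(x) = x V_h(x^{1/10})/log x`, for every `ε > 0` and all large `x`
(A) `S(𝒜_h(x), ⌈x^{1/10}⌉) ≥ (f₁(5) − ε) W_h(x)`, (B) `∑_{⌈x^{1/10}⌉ ≤ q < y} S(𝒜_h(x)_q, ⌈x^{1/10}⌉) ≤ (b + ε) W_h(x)`
and (C) `S(B_h(x), y) ≤ ((2e^γ/5)c' + ε) W_h(x)` (`y = chenY h x`, `b = ∫_{1/10}^{1/3} F₁(5 − 10β) dβ/β`,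
`c' = switchingConstantTenth`), then `x_h(1,2) ≥ 0.67 x C_h/(log x)²` for all large `x`.
Proof: (34) gives `x_h(1,2) ≥ S − ½∑ − ½(y + S(B_h, y)) − (x+h)/(z−1) ≥ (f₁(5) − b/2 − (e^γ/5)c' − 2ε) W_h − 6x^{9/10}`;
`W_h ≥ (1 − ε) 20e^{−γ} C_h x/(log x)²` (Mertens) and `20e^{−γ}(f₁(5) − b/2 − (e^γ/5)c') > 0.676`, so with
`ε = 10⁻⁴` the right side is `≥ (0.9999 · 0.672 − 0.0005) C_h x/(log x)² ≥ 0.67 C_h x/(log x)²`.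
[cite: ChenSciSinica1973, §III and Theorem II (reprint p. 168)] -/
theorem shiftedPrimeAlmostPrimeCount_ge_of {h : ℕ} (hh : Even h) (hh0 : h ≠ 0)
    (hA : ∀ ε : ℝ, 0 < ε → ∀ᶠ x : ℕ in atTop,
      (lowerSieveFun 1 5 - ε) * ((x : ℝ) * sieveProduct h ((x : ℝ) ^ (1 / 10 : ℝ)) / Real.log x) ≤
        roughCount (shiftSieveSet h x) (chenZ x))
    (hB : ∀ ε : ℝ, 0 < ε → ∀ᶠ x : ℕ in atTop,
      (∑ q ∈ primesIco (chenZ x) (chenY h x), (roughMultCount (shiftSieveSet h x) (chenZ x) q : ℝ)) ≤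
        ((∫ β in (1 / 10 : ℝ)..(1 / 3), upperSieveFun 1 (5 - 10 * β) / β) + ε) * ((x : ℝ) * sieveProduct h ((x : ℝ) ^ (1 / 10 : ℝ)) / Real.log x))
    (hC : ∀ ε : ℝ, 0 < ε → ∀ᶠ x : ℕ in atTop,
      (roughCount (chenSetBShift h x) (chenY h x) : ℝ) ≤
        (2 * Real.exp Real.eulerMascheroniConstant / 5 * switchingConstantTenth + ε) *
          ((x : ℝ) * sieveProduct h ((x : ℝ) ^ (1 / 10 : ℝ)) / Real.log x)) :
    ∃ x₀ : ℕ, ∀ x : ℕ, x₀ ≤ x →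
      0.67 * (x : ℝ) * singularSeries h / Real.log x ^ 2 ≤ shiftedPrimeAlmostPrimeCount h x := by
  set G : ℝ := Real.exp Real.eulerMascheroniConstant with hG
  set f5 : ℝ := lowerSieveFun 1 5 with hf5
  set b : ℝ := ∫ β in (1 / 10 : ℝ)..(1 / 3), upperSieveFun 1 (5 - 10 * β) / β with hb
  set c' : ℝ := switchingConstantTenth with hc'
  -- the (C)-constant as one atom
  set c : ℝ := 2 * G / 5 * c' with hc
  have hGinv : Real.exp (-Real.eulerMascheroniConstant) ≤ 1 :=
    Real.exp_le_one_iff.mpr (by linarith [Real.one_half_lt_eulerMascheroniConstant])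
  have hGinv0 : 0 < Real.exp (-Real.eulerMascheroniConstant) := Real.exp_pos _
  have hmargin : (0.676 : ℝ) < 20 * Real.exp (-Real.eulerMascheroniConstant) * (f5 - b / 2 - c / 2) := by
    have h0 : (0.676 : ℝ) < 20 * Real.exp (-Real.eulerMascheroniConstant) * (f5 - b / 2 - G / 5 * c') :=
      chen_theoremII_margin
    have e : f5 - b / 2 - c / 2 = f5 - b / 2 - G / 5 * c' := by rw [hc]; ring
    rwa [e]
  -- the working accuracy
  set ε : ℝ := 1 / 10000 with hε
  have hε0 : (0 : ℝ) < ε := by norm_num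
  have hC2 : 0 < twinPrimeConst := twinPrimeConst_pos_holds
  have hjunk := eventually_rpow_le_mul_div_log_sq (θ := 9 / 10) (K := 6)
    (c := 5 / 10000 * twinPrimeConst) (by norm_num) (by positivity)
  have hev : ∀ᶠ x : ℕ in atTop,
      0.67 * (x : ℝ) * singularSeries h / Real.log x ^ 2 ≤ shiftedPrimeAlmostPrimeCount h x := by
    filter_upwards [hA ε hε0, hB ε hε0, hC ε hε0, eventually_shiftUnit_ge hh hh0 hε0, hjunk,
      eventually_ge_atTop (max 1024 (h + 1))] with x hAx hBx hCx hWx hjx hx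
    have hx1024 : 1024 ≤ x := le_of_max_le_left hx
    have hhx : h + 1 ≤ x := le_of_max_le_right hx
    have hx1 : (1 : ℝ) < x := by exact_mod_cast (show 1 < x by omega)
    have hx0 : (0 : ℝ) < x := by linarith
    have hlog : 0 < Real.log x := Real.log_pos hx1
    -- the unit and Chen's main term
    set W : ℝ := (x : ℝ) * sieveProduct h ((x : ℝ) ^ (1 / 10 : ℝ)) / Real.log x with hW
    set M : ℝ := singularSeries h * x / Real.log x ^ 2 with hM
    have hS := singularSeries_pos h
    have hM0 : 0 ≤ M := by positivity
    have hC2M : twinPrimeConst * x / Real.log x ^ 2 ≤ M := by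
      rw [hM]
      have := twinPrimeConst_le_singularSeries h
      gcongr
    -- (34) and the passage to `B_h`
    have hWS := weightedSieve' (A := shiftSieveSet h x) (z := chenZ x) (y := chenY h x)
      (shiftSieveSet_subset_Ioc h x) (lt_chenY_pow h x) (two_le_chenZ (by omega))
    have hT : (tripleCount (shiftSieveSet h x) (chenZ x) (chenY h x) : ℝ) ≤
        chenY h x + roughCount (chenSetBShift h x) (chenY h x) := by
      exact_mod_cast tripleCount_shift_le h x
    have hP2 : (almostPrimeTwoCount (shiftSieveSet h x) : ℝ) ≤ shiftedPrimeAlmostPrimeCount h x := by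
      exact_mod_cast almostPrimeTwoCount_shift_le h x
    have hE := chen_shift_errorTerms_le hx1024 hhx
    have hcast : ((x + h : ℕ) : ℝ) = (x : ℝ) + h := by push_cast; ring
    rw [hcast] at hWS
    -- the main coefficient `m = f5 - b/2 - c/2`
    have hmpos : 0 < f5 - b / 2 - c / 2 := by
      rcases lt_or_ge 0 (f5 - b / 2 - c / 2) with hpos | hle
      · exact hpos
      · have : 20 * Real.exp (-Real.eulerMascheroniConstant) * (f5 - b / 2 - c / 2) ≤ 0 :=
          mul_nonpos_of_nonneg_of_nonpos (by positivity) hle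
        linarith
    have h20 : 20 * Real.exp (-Real.eulerMascheroniConstant) * (f5 - b / 2 - c / 2) ≤
        20 * (f5 - b / 2 - c / 2) := by
      have := mul_le_mul_of_nonneg_right hGinv (mul_nonneg (by norm_num : (0 : ℝ) ≤ 20) hmpos.le)
      linarith
    have hm0 : 0 ≤ f5 - b / 2 - c / 2 - 2 * ε := by
      rw [hε]
      linarith
    have h1 : (f5 - b / 2 - c / 2 - 2 * ε) * ((1 - ε) *
        (20 * Real.exp (-Real.eulerMascheroniConstant) * M)) ≤
        (f5 - b / 2 - c / 2 - 2 * ε) * W := mul_le_mul_of_nonneg_left hWx hm0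
    have h2 : (1 - ε) * (0.676 - 40 * ε) * M ≤ (f5 - b / 2 - c / 2 - 2 * ε) * ((1 - ε) *
        (20 * Real.exp (-Real.eulerMascheroniConstant) * M)) := by
      have e : (f5 - b / 2 - c / 2 - 2 * ε) * ((1 - ε) *
          (20 * Real.exp (-Real.eulerMascheroniConstant) * M)) =
          (1 - ε) * (20 * Real.exp (-Real.eulerMascheroniConstant) * (f5 - b / 2 - c / 2) -
            40 * Real.exp (-Real.eulerMascheroniConstant) * ε) * M := by ring
      rw [e]
      refine mul_le_mul_of_nonneg_right (mul_le_mul_of_nonneg_left ?_ (by rw [hε]; norm_num)) hM0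
      have : 40 * Real.exp (-Real.eulerMascheroniConstant) * ε ≤ 40 * ε := by
        have := mul_le_mul_of_nonneg_left hGinv (show (0 : ℝ) ≤ 40 * ε by positivity)
        linarith
      linarith
    have hnum : (1 - ε) * (0.676 - 40 * ε) = 6719328 / 10000000 := by rw [hε]; norm_num
    rw [hnum] at h2
    -- name the sieve quantities (atoms for `linarith`)
    set S : ℝ := (roughCount (shiftSieveSet h x) (chenZ x) : ℝ) with hSdef
    set Sg : ℝ := ∑ q ∈ primesIco (chenZ x) (chenY h x),
      (roughMultCount (shiftSieveSet h x) (chenZ x) q : ℝ) with hSgdef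
    set T : ℝ := (tripleCount (shiftSieveSet h x) (chenZ x) (chenY h x) : ℝ) with hTdef
    set SB : ℝ := (roughCount (chenSetBShift h x) (chenY h x) : ℝ) with hSBdef
    set Y : ℝ := (chenY h x : ℝ) with hYdef
    set J : ℝ := ((x : ℝ) + h) / ((chenZ x : ℝ) - 1) with hJdef
    set P2 : ℝ := (almostPrimeTwoCount (shiftSieveSet h x) : ℝ) with hP2def
    set E6 : ℝ := 6 * (x : ℝ) ^ (9 / 10 : ℝ) with hE6def
    set Xh : ℝ := (shiftedPrimeAlmostPrimeCount h x : ℝ) with hXhdef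
    have hjx' : E6 ≤ 5 / 10000 * (twinPrimeConst * x / Real.log x ^ 2) := by
      rw [show 5 / 10000 * (twinPrimeConst * x / Real.log x ^ 2) =
        5 / 10000 * twinPrimeConst * x / Real.log x ^ 2 by ring]
      exact hjx
    have hgoal : 0.67 * (x : ℝ) * singularSeries h / Real.log x ^ 2 = 67 / 100 * M := by
      rw [hM]; ring
    rw [hgoal]
    set Cx : ℝ := twinPrimeConst * x / Real.log x ^ 2 with hCxdef
    set Eg : ℝ := Real.exp (-Real.eulerMascheroniConstant) with hEgdef
    -- make all named quantities opaque (`set` leaves `let`-values that `linarith` may unfold)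
    clear_value Eg Cx Xh E6 P2 J Y SB T Sg S M W ε c c' b f5 G
    have v1 : S - Sg / 2 - SB / 2 ≤ P2 + Y / 2 + J := by linarith [hWS, hT]
    have v2 : P2 + Y / 2 + J ≤ Xh + E6 := by linarith [hP2, hE]
    have hkey : (f5 - b / 2 - c / 2 - 2 * ε) * W =
        (f5 - ε) * W - (b + ε) * W / 2 - (c + ε) * W / 2 := by ring
    have v3 : (f5 - b / 2 - c / 2 - 2 * ε) * W ≤ S - Sg / 2 - SB / 2 := by
      rw [hkey]; linarith [hAx, hBx, hCx]
    have t1 : 6719328 / 10000000 * M ≤ S - Sg / 2 - SB / 2 := (h2.trans h1).trans v3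
    have t3 : E6 ≤ 5 / 10000 * M := by linarith [hjx', hC2M]
    linarith [t1, t3, v1, v2, hM0]
  obtain ⟨x₀, hx₀⟩ := eventually_atTop.mp hev
  exact ⟨x₀, hx₀⟩

/-- **Chen's Theorem II from the three sieve estimates at Chen's parameters.** If (A), (B), (C) of
`shiftedPrimeAlmostPrimeCount_ge_of` hold for every even `h ≠ 0`, then
`Literature.NumberTheory.Sieve.Chen.Chen1973_theoremII` (`x_h(1,2) ≥ 0.67 x C_h/(log x)²` for every
even `h ≠ 0` and all large even `x`) holds. [cite: ChenSciSinica1973, Theorem II and §III (reprint pp. 150, 168)] -/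
theorem Chen1973_theoremII_of
    (hA : ∀ h : ℕ, Even h → h ≠ 0 → ∀ ε : ℝ, 0 < ε → ∀ᶠ x : ℕ in atTop,
      (lowerSieveFun 1 5 - ε) * ((x : ℝ) * sieveProduct h ((x : ℝ) ^ (1 / 10 : ℝ)) / Real.log x) ≤
        roughCount (shiftSieveSet h x) (chenZ x))
    (hB : ∀ h : ℕ, Even h → h ≠ 0 → ∀ ε : ℝ, 0 < ε → ∀ᶠ x : ℕ in atTop,
      (∑ q ∈ primesIco (chenZ x) (chenY h x), (roughMultCount (shiftSieveSet h x) (chenZ x) q : ℝ)) ≤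
        ((∫ β in (1 / 10 : ℝ)..(1 / 3), upperSieveFun 1 (5 - 10 * β) / β) + ε) * ((x : ℝ) * sieveProduct h ((x : ℝ) ^ (1 / 10 : ℝ)) / Real.log x))
    (hC : ∀ h : ℕ, Even h → h ≠ 0 → ∀ ε : ℝ, 0 < ε → ∀ᶠ x : ℕ in atTop,
      (roughCount (chenSetBShift h x) (chenY h x) : ℝ) ≤
        (2 * Real.exp Real.eulerMascheroniConstant / 5 * switchingConstantTenth + ε) *
          ((x : ℝ) * sieveProduct h ((x : ℝ) ^ (1 / 10 : ℝ)) / Real.log x)) :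
    Chen1973_theoremII := by
  intro h hh hh0
  obtain ⟨x₀, hx₀⟩ :=
    shiftedPrimeAlmostPrimeCount_ge_of hh hh0 (hA h hh hh0) (hB h hh hh0) (hC h hh hh0)
  exact ⟨x₀, fun x hx _ => hx₀ x hx⟩

end Literature.NumberTheory.Sieve.Chen
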